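import Summits.Ventures.DiscreteObjects.Hadamard.ConferenceGraph333Centralizer41
import Summits.Ventures.DiscreteObjects.Hadamard.ConferenceGraph333InvertingInvolutions
import Summits.Ventures.DiscreteObjects.Hadamard.ConferenceGraph333Centralizer83

/-!
# Gen-31 summary: the involution chapter of the Aut(srg(333,166,82,83)) census in one statement (kernel)

Framing: lottery ticket; floor = certified bounds/negative ranges.  Cell pub-namedobj (venture DiscreteObjects),
target (H) = `H(668)`, hadamard gen 31.  One conjunction restating, with their hypotheses, the gen-31 facts about involutions `τ` of a
hypothetical `srg(333,166,82,83)` (`⇔` symmetric `C(334)` fixing the border, `⇒ H(668)`), for the table and the referee: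
(1) window `f ≡ 1 (mod 4)`, `f ≤ 149` (`ConferenceGraph333InvolutionBound149`); (2) order `82` ⇒ `#Fix σ = 1`, `#Fix σ² = 5`, `#Fix σ⁴¹ = 1`
(`…Order82`); (3) `τ` commuting with `ρ` of order `41` ⇒ `#Fix τ = 1`, with `ρ` of order `37` ⇒ `#Fix τ = 37` (`…CentralizingInvolutions`),
with `ρ` of order `83` ⇒ `#Fix τ = 1` (gen 30, `…Centralizer83`); (4) no two distinct commuting involutions commute with an element of order `41`
(`…Centralizer41`) or `83` (gen 30); (5) `τ` inverting `ρ` (`ρτρ = τ`) of order `83 / 41 / 37` ⇒ `#Fix τ ∈ {1,5} / {1,5,9,13} / {1,5,9}`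
(`…InvertingInvolutions`).  No new mathematics; WORDS: structure of a HYPOTHETICAL object (nothing about H(668) is excluded); ours (PROVISIONAL).
No `sorry`, no new definitions.
-/

namespace Summit.Ventures.DiscreteObjects.Hadamard

open Finset

section summaryG31
variable {V : Type*} [Fintype V] [DecidableEq V]

/-- **Involution chapter of the census (gen 31), one statement.**  For an `srg(333,166,82,83)` with adjacency matrix `A`:
(1) every involution fixes `f ≡ 1 (mod 4)`, `f ≤ 149` vertices; (2) an element of order `82` has `#Fix σ = 1`, `#Fix σ² = 5`, `#Fix σ⁴¹ = 1`;
(3) an involution commuting with an element of order `83`, `41`, `37` fixes exactly `1`, `1`, `37` vertices; (4) no two distinct commuting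
involutions commute with an element of order `83` or `41`; (5) an involution inverting an element of order `83`, `41`, `37` fixes
`∈ {1,5}`, `∈ {1,5,9,13}`, `∈ {1,5,9}` vertices. -/
theorem involution_census_summary_g31 (hV : Fintype.card V = 333) (A : Matrix V V ℤ)
    (h01 : ∀ x y, A x y = 0 ∨ A x y = 1) (hsymm : ∀ x y, A y x = A x y) (hdiag : ∀ x, A x x = 0)
    (hk : ∀ x, ∑ y, A x y = 166) (hsrg : ∀ x y, ∑ z, A x z * A z y = 83 * (1 + (if x = y then 1 else 0)) - A x y) :
    -- (1) the involution window
    (∀ τ : Equiv.Perm V, (∀ x, τ (τ x) = x) → τ ≠ 1 → (∀ x y, A (τ x) (τ y) = A x y) →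
      (univ.filter fun x => τ x = x).card % 4 = 1 ∧ (univ.filter fun x => τ x = x).card ≤ 149) ∧
    -- (2) order 82
    (∀ σ : Equiv.Perm V, σ ^ 82 = 1 → σ ^ 41 ≠ 1 → σ ^ 2 ≠ 1 → (∀ x y, A (σ x) (σ y) = A x y) →
      (univ.filter fun x => σ x = x).card = 1 ∧ (univ.filter fun x => (σ ^ 2) x = x).card = 5 ∧
        (univ.filter fun x => (σ ^ 41) x = x).card = 1) ∧
    -- (3) centralising involutions at 83, 41, 37
    (∀ ρ τ : Equiv.Perm V, τ ^ 2 = 1 → τ ≠ 1 → ρ ≠ 1 → ρ * τ = τ * ρ →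
      (∀ x y, A (ρ x) (ρ y) = A x y) → (∀ x y, A (τ x) (τ y) = A x y) →
      (ρ ^ 83 = 1 → (univ.filter fun x => τ x = x).card = 1) ∧
      (ρ ^ 41 = 1 → (univ.filter fun x => τ x = x).card = 1) ∧
      (ρ ^ 37 = 1 → (univ.filter fun x => τ x = x).card = 37)) ∧
    -- (4) no commuting pair of involutions centralising an element of order 83 or 41
    (∀ ρ τ₁ τ₂ : Equiv.Perm V, (ρ ^ 83 = 1 ∨ ρ ^ 41 = 1) → ρ ≠ 1 → τ₁ ^ 2 = 1 → τ₂ ^ 2 = 1 → τ₁ ≠ 1 → τ₂ ≠ 1 → τ₁ ≠ τ₂ →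
      ρ * τ₁ = τ₁ * ρ → ρ * τ₂ = τ₂ * ρ → τ₁ * τ₂ = τ₂ * τ₁ → (∀ x y, A (ρ x) (ρ y) = A x y) →
      (∀ x y, A (τ₁ x) (τ₁ y) = A x y) → (∀ x y, A (τ₂ x) (τ₂ y) = A x y) → False) ∧
    -- (5) inverting involutions at 83, 41, 37
    (∀ ρ τ : Equiv.Perm V, (∀ x, τ (τ x) = x) → ρ ≠ 1 → ρ * τ * ρ = τ →
      (∀ x y, A (ρ x) (ρ y) = A x y) → (∀ x y, A (τ x) (τ y) = A x y) →
      (ρ ^ 83 = 1 → (univ.filter fun x => τ x = x).card = 1 ∨ (univ.filter fun x => τ x = x).card = 5) ∧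
      (ρ ^ 41 = 1 → (univ.filter fun x => τ x = x).card = 1 ∨ (univ.filter fun x => τ x = x).card = 5 ∨
        (univ.filter fun x => τ x = x).card = 9 ∨ (univ.filter fun x => τ x = x).card = 13) ∧
      (ρ ^ 37 = 1 → (univ.filter fun x => τ x = x).card = 1 ∨ (univ.filter fun x => τ x = x).card = 5 ∨
        (univ.filter fun x => τ x = x).card = 9)) := by
  refine ⟨fun τ hτ hτ1 hA => involution_window_149 hV A h01 hsymm hdiag hk hsrg τ hτ hτ1 hA,
    fun σ h82 h41 h2 hA => aut_order82_cycle_type hV A h01 hsymm hdiag hk hsrg σ h82 h41 h2 hA,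
    fun ρ τ hτ hτ1 hρ1 hc hAρ hAτ => ⟨fun hρ => ?_, fun hρ => ?_, fun hρ => ?_⟩,
    fun ρ τ₁ τ₂ hρ hρ1 h1 h2 hτ₁ hτ₂ hne hc1 hc2 hc12 hAρ hA1 hA2 => ?_,
    fun ρ τ hτ hρ1 hc hAρ hAτ => ⟨fun hρ => ?_, fun hρ => ?_, fun hρ => ?_⟩⟩
  · exact involution_centralizing_order83_fixed_one hV A h01 hsymm hdiag hk hsrg ρ τ hρ hρ1 hτ hτ1 hc hAρ hAτ
  · exact (involution_centralizing_order41_fixed_one hV A h01 hsymm hdiag hk hsrg ρ τ hρ hρ1 hτ hτ1 hc hAρ hAτ).1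
  · exact involution_centralizing_order37_fixed hV A h01 hsymm hdiag hk hsrg ρ τ hρ hρ1 hτ hτ1 hc hAρ hAτ
  · rcases hρ with hρ | hρ
    · exact no_two_involutions_centralizing_order83 hV A h01 hsymm hdiag hk hsrg ρ τ₁ τ₂ hρ hρ1 h1 hτ₁ h2 hτ₂ hne hc1 hc2
        hc12 hAρ hA1 hA2
    · exact no_two_involutions_centralizing_order41 hV A h01 hsymm hdiag hk hsrg ρ τ₁ τ₂ hρ hρ1 h1 h2 hτ₁ hτ₂ hne hc1 hc2
        hc12 hAρ hA1 hA2
  · exact involution_inverting_order83_fixed hV A h01 hsymm hdiag hk hsrg ρ τ hρ hρ1 hτ hc hAρ hAτ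
  · exact involution_inverting_order41_fixed hV A h01 hsymm hdiag hk hsrg ρ τ hρ hρ1 hτ hc hAρ hAτ
  · exact involution_inverting_order37_fixed hV A h01 hsymm hdiag hk hsrg ρ τ hρ hρ1 hτ hc hAρ hAτ

end summaryG31

end Summit.Ventures.DiscreteObjects.Hadamard
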